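import Literature.NumberTheory.EllipticCurves.BhargavaShankarParametrizationProofs
import HarnessLib

/-!
# Bhargava–Shankar, Cor. 1.2 (average rank `≤ 3/2`) needs only the *upper* half of eq. (31):
# the one-sided route `(U†) ∧ Thm 2.1 ⇒ (U31) ⇒ limsup Avg #S₂ ≤ 3 ⇒ average rank ≤ 3/2`

`Proofs` companion (theorems only: no definitions, no named facts) of `BhargavaShankarCounting.lean`
and `BhargavaShankarLocalMasses.lean`. Source: M. Bhargava, A. Shankar, *Binary quartic forms having
bounded invariants, and the boundedness of the average rank of elliptic curves*, Ann. of Math. (2)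
181 (2015) 191–242; numbering of the held arXiv text `arXiv:1006.1002v2` (its §5.4, display (31),
Thm 5.14, Lemma 5.15; §3.7, proof of Prop. 3.19), published version (= v3) in brackets.

## Why this file exists (review of the decomposition of `averageRankLE_three_halves`)

The tree derives Cor. 1.2 (`averageRankLE_three_halves`, a `limsup` statement:
`AverageRankLE = HeightAverageLE`) from Theorem 1.1 in `limsup` form
(`heightAverageLE_card_selmerTwo`, `BSDWave0Proofs.averageRankLE_three_halves_of_heightAverageLE_card_selmerTwo`),
and Theorem 1.1 from the *two-sided* asymptotic eq. (31)
(`bhargavaShankar_sum_irredClassCount_asymptotic`: `Σ_{H(E)<X} #{irreducible locally soluble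
classes} = 2c_F X^{5/6} + o(X^{5/6})`), itself reduced to the two-sided sieve step (†)
(`bhargavaShankar_locSolIrredClassCount_asymptotic`) and Thm 2.1 (`bhargavaShankar_classCount`)
(`BhargavaShankarEq31FrontierProofs`). In the source the two halves of (†) have very different
price tags. The printed sieve (v2: "the proof is again identical to that of Theorem (mcc)", i.e.
§3.7, proof of Prop. 3.19, p. 20; v3: proof of Thm 2.21, §2.7) obtains the **upper bound**
`limsup_X N_φ/X^{5/6} ≤ lim_X N/X^{5/6} · ∏_p ∫φ_p` from the count with *finitely many* congruence
conditions alone (v2 Thm 2.11, used as in the proof of Prop. 3.19, p. 20: "Letting `Y` tend to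
infinity, we obtain that limsup …"; v3 Thm 2.12 and the upper envelopes `ψ'`), whereas the **lower bound** needs the uniformity estimate (v2 Prop. 3.18 = Prop. 5.13,
"significantly more difficult", proved in §4 through pairs of ternary quadratic forms, the
parametrization of quartic rings and [dodqf]; v3 Thm 2.13 via [geosieve, Thm 3.3],
[dodqf, Prop. 23] and the Delone–Evertse bound, Prop. 2.16) — inputs external to the paper.

This file records, sorry-free, that **Cor. 1.2 only needs the upper half**: writing

* (U†) for the upper sieve step: for every `ε > 0`, eventually in real `X`,
  `N(S^F; 2¹²X) ≤ N(V_ℤ^{(0)} ∪ V_ℤ^{(2+)} ∪ V_ℤ^{(1)}; 2¹²X) · ∏_p |2¹⁰/3³|_p M_p(V,F) + ε X^{5/6}`;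
* (U31) for the upper eq. (31): for every `ε > 0`, eventually in `X : ℕ`,
  `Σ_{H(E_{A,B}) < X} #{PGL₂(ℚ)-classes of loc. sol. irreducible quartics with invariants
  2⁴I(E), 2⁶J(E)} ≤ (2c_F + ε) X^{5/6}` (`c_F = heightFamilyConstant`),

we prove (U†) ∧ Thm 2.1 ⇒ (U31) (`sum_irredClassCount_le_of_upperSieve`, the one-sided twin of
`sum_irredClassCount_asymptotic_of_sieve`, same constant bookkeeping `eq31_constant`,
`hasProd_localFactor`, Lemma 5.16 = `brumerKramer_card_quotient_two_holds`), (U31) ⇒ Theorem 1.1 in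
`limsup` form (`heightAverageLE_card_selmerTwo_of_sum_irredClassCount_le`: as in §5.4, with
Thm 5.6 = `bhargavaShankar_card_selmerTwo_eq_holds`, Prop. 5.8 =
`bhargavaShankar_sum_card_selmerTwo_twoTorsion_le_holds`, Lemma 5.15 =
`card_heightFamilyBelow_asymptotic_holds`, and `Σ #S₂ ≤ Σ #irr + N_X + Σ_{2-torsion} #S₂`), hence
(U31) ⇒ Cor. 1.2 and **(U†) ∧ Thm 2.1 ⇒ Cor. 1.2** (`averageRankLE_three_halves_of_upperSieve`).
The one-sided statements are of course implied by the two-sided named facts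
(`upperSieveStep_of_sieveStep`, `sum_irredClassCount_le_of_asymptotic`), so nothing is lost.
(U†) and (U31) are written out in the binders (no new named facts).

Consequence for the proof campaign: the named fact `averageRankLE_three_halves` is reachable from
Thm 2.1/2.12 (the averaging method with finitely many congruence weights), Props. 3.6/3.9 of v3
(`m = ∏ m_p`, `∫φ_p = |2¹⁰/27|_p M_p(V,F)`; tree: `BhargavaShankarWeightProduct`,
`BhargavaShankarLocalMassesProofs`, `BhargavaShankarLocalOrbitMass`, …) and the upper envelope
argument (`BhargavaShankarSieveSkeletonProofs` §3, `BinaryQuarticCongruenceEnvelopesProofs`),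
without Thm 2.13 / Prop. 5.13 and without [dodqf] or Delone–Evertse; only Theorem 1.1 proper
(`average_card_selmerTwo`, the limit `= 3`) needs the lower half.

## References

* M. Bhargava, A. Shankar, Ann. of Math. (2) 181 (2015) 191–242 = arXiv:1006.1002; v2: §5.4
  display (31), Lemma 5.15, Props. 5.7–5.8, Thm 5.6, Cor. 1.2; §3.7 proof of Prop. 3.19 (p. 20);
  Prop. 3.18 and §4. v3: Thms 2.12, 2.13, 2.21, 3.19.
  [cite: BhargavaShankarAnnals2015, §5.4 eq. (31) and Cor. 1.2 (arXiv:1006.1002v2 numbering)]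
-/

noncomputable section

open scoped Classical
open Filter Topology Finset

namespace Literature.NumberTheory.EllipticCurves

open BinaryQuartic

/-! ## §1. The one-sided statements follow from the two-sided named facts -/

/-- (†) ⇒ (U†): the two-sided sieve step `bhargavaShankar_locSolIrredClassCount_asymptotic`
implies its upper half. [cite: BhargavaShankarAnnals2015, §5.4 eq. (31), second line (arXiv:1006.1002v2 numbering)] -/
theorem upperSieveStep_of_sieveStep (hG : bhargavaShankar_locSolIrredClassCount_asymptotic) :
    ∀ ε : ℝ, 0 < ε → ∀ᶠ X : ℝ in atTop,
      (locSolIrredClassCount (2 ^ 12 * X) : ℝ) ≤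
        (gl2zClassCount (fourRealRoots ∪ posDefinite ∪ twoRealRoots) (2 ^ 12 * X) : ℝ) *
            (∏' p : Nat.Primes, ((padicNorm p (2 ^ 10 / 3 ^ 3) : ℚ) : ℝ) *
              @localMassV p ⟨p.2⟩) +
          ε * X ^ (5 / 6 : ℝ) := by
  intro ε hε
  have h : Tendsto _ atTop (𝓝 (0 : ℝ)) := hG
  filter_upwards [h.eventually_lt_const hε, eventually_gt_atTop 0] with X hX hX0
  have hXpow : 0 < X ^ (5 / 6 : ℝ) := Real.rpow_pos_of_pos hX0 _
  have := (div_lt_iff₀ hXpow).mp hX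
  linarith

/-- eq. (31) ⇒ (U31): the two-sided `bhargavaShankar_sum_irredClassCount_asymptotic` implies its
upper half. [cite: BhargavaShankarAnnals2015, §5.4 eq. (31) (arXiv:1006.1002v2 numbering)] -/
theorem sum_irredClassCount_le_of_asymptotic (h31 : bhargavaShankar_sum_irredClassCount_asymptotic) :
    ∀ ε : ℝ, 0 < ε → ∀ᶠ X : ℕ in atTop,
      (∑ AB ∈ heightFamilyBelow X,
          (pgl2QClassCount {f : BinaryQuartic ℤ | f.IsLocallySoluble ∧ f.IsIrreducible ∧
              f.I = 2 ^ 4 * (-3 * AB.1) ∧ f.J = 2 ^ 6 * (-27 * AB.2)} : ℝ)) ≤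
        (2 * heightFamilyConstant + ε) * (X : ℝ) ^ (5 / 6 : ℝ) := by
  intro ε hε
  have h : Tendsto _ atTop (𝓝 (2 * heightFamilyConstant)) := h31
  filter_upwards [h.eventually_lt_const (lt_add_of_pos_right _ hε), eventually_gt_atTop 0]
    with X hX hX0
  have hXpow : 0 < (X : ℝ) ^ (5 / 6 : ℝ) := Real.rpow_pos_of_pos (by exact_mod_cast hX0) _
  exact ((div_lt_iff₀ hXpow).mp hX).le


/-! ## §2. (U†) ∧ Thm 2.1 ⇒ (U31): the one-sided twin of `sum_irredClassCount_asymptotic_of_sieve` -/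

/-- **The upper half of eq. (31) from the upper sieve step and Thm 2.1.** If for every `ε > 0`,
eventually `N(S^F; 2¹²X) ≤ N(V_ℤ^{(0)} ∪ V_ℤ^{(2+)} ∪ V_ℤ^{(1)}; 2¹²X)·∏_p |2¹⁰/3³|_p M_p(V,F) + εX^{5/6}`
(the `limsup` half of the second line of display (31), which the printed sieve obtains from the
count with finitely many congruence conditions, without the uniformity estimate), then, by lines
3–4 of (31) (Thm 2.1: `N(V^{(0)} ∪ V^{(2+)} ∪ V^{(1)}; Y) ~ (8/27)ζ(2)Y^{5/6}`; the product formula;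
Lemma 5.16, a theorem of the tree) and `N(S^F; 2¹⁰·27·X) = Σ_{H(E_{A,B})<X} #{classes}`, for every
`ε > 0`, eventually `Σ_{H(E_{A,B}) < X} #{classes} ≤ (2c_F + ε)·X^{5/6}`.
[cite: BhargavaShankarAnnals2015, §5.4 eq. (31) with Prop. 5.12 and Lemma 5.16; §3.7 proof of Prop. 3.19 (arXiv:1006.1002v2 numbering)] -/
theorem sum_irredClassCount_le_of_upperSieve
    (hU : ∀ ε : ℝ, 0 < ε → ∀ᶠ X : ℝ in atTop,
      (locSolIrredClassCount (2 ^ 12 * X) : ℝ) ≤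
        (gl2zClassCount (fourRealRoots ∪ posDefinite ∪ twoRealRoots) (2 ^ 12 * X) : ℝ) *
            (∏' p : Nat.Primes, ((padicNorm p (2 ^ 10 / 3 ^ 3) : ℚ) : ℝ) *
              @localMassV p ⟨p.2⟩) +
          ε * X ^ (5 / 6 : ℝ))
    (h16 : bhargavaShankar_classCount) :
    ∀ ε : ℝ, 0 < ε → ∀ᶠ X : ℕ in atTop,
      (∑ AB ∈ heightFamilyBelow X,
          (pgl2QClassCount {f : BinaryQuartic ℤ | f.IsLocallySoluble ∧ f.IsIrreducible ∧
              f.I = 2 ^ 4 * (-3 * AB.1) ∧ f.J = 2 ^ 6 * (-27 * AB.2)} : ℝ)) ≤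
        (2 * heightFamilyConstant + ε) * (X : ℝ) ^ (5 / 6 : ℝ) := by
  intro ε hε
  -- notation
  set c₁ : ℝ := (2 : ℝ) ^ 10 * 27 with hc₁
  have hc₁pos : 0 < c₁ := by rw [hc₁]; norm_num
  set κ : ℝ := 8 / 27 * (Real.pi ^ 2 / 6) with hκ
  set P : ℝ := ∏' p : Nat.Primes, ((padicNorm p ((2 : ℚ) ^ 10 / 3 ^ 3) : ℚ) : ℝ) *
    @localMassV p ⟨p.2⟩ with hP
  set E₁₀ : ℝ := ∏' p : Nat.Primes, (1 - 1 / ((p : ℕ) : ℝ) ^ 10) with hE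
  set N' : ℝ → ℝ := fun Y ↦ (gl2zClassCount (fourRealRoots ∪ posDefinite ∪ twoRealRoots) Y : ℝ)
    with hN'
  set L : ℝ → ℝ := fun Y ↦ (locSolIrredClassCount Y : ℝ) with hL
  have hPval : P = ((2 : ℝ) ^ 9)⁻¹ * (3 : ℝ)⁻¹ * (6 / Real.pi ^ 2) * E₁₀ :=
    (hasProd_localFactor brumerKramer_card_quotient_two_holds).tprod_eq
  -- the constant `κ c₁^{5/6} P = 2 c_F` (lines 3–4 of (31) and the last display of §5.4)
  have hconst : κ * c₁ ^ (5 / 6 : ℝ) * P = 2 * heightFamilyConstant := by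
    rw [hPval, heightFamilyConstant, hκ, hc₁, ← hE]
    have := eq31_constant
    calc 8 / 27 * (Real.pi ^ 2 / 6) * ((2 : ℝ) ^ 10 * 27) ^ (5 / 6 : ℝ) *
          (((2 : ℝ) ^ 9)⁻¹ * (3 : ℝ)⁻¹ * (6 / Real.pi ^ 2) * E₁₀)
        = (8 / 27 * (Real.pi ^ 2 / 6) * ((2 : ℝ) ^ 10 * 27) ^ (5 / 6 : ℝ) *
            (((2 : ℝ) ^ 9)⁻¹ * (3 : ℝ)⁻¹ * (6 / Real.pi ^ 2))) * E₁₀ := by ring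
      _ = 2 * (4 / ((4 : ℝ) ^ (1 / 3 : ℝ) * (27 : ℝ) ^ (1 / 2 : ℝ))) * E₁₀ := by rw [this]
      _ = 2 * (4 / ((4 : ℝ) ^ (1 / 3 : ℝ) * (27 : ℝ) ^ (1 / 2 : ℝ)) * E₁₀) := by ring
  -- (1) `N'(c₁X)/X^{5/6} → κ c₁^{5/6}` along `X : ℕ` (Thm 2.1, third line of (31))
  have hN'lim : Tendsto (fun X : ℕ ↦ N' (c₁ * X) / (X : ℝ) ^ (5 / 6 : ℝ)) atTop
      (𝓝 (κ * c₁ ^ (5 / 6 : ℝ))) := by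
    obtain ⟨C, hC⟩ := abs_classCount_union_sub_le h16
    have hdiff : Tendsto (fun X : ℕ ↦ |N' (c₁ * X) - κ * (c₁ * X) ^ (5 / 6 : ℝ)| /
        (X : ℝ) ^ (5 / 6 : ℝ)) atTop (𝓝 0) := by
      refine tendsto_div_rpow_fiveSixths_of_le (C := |C| * c₁ ^ (3 / 4 + 1 / 24 : ℝ))
        (a := 3 / 4 + 1 / 24) (by norm_num) (fun X ↦ abs_nonneg _) fun X hX ↦ ?_
      have hX1 : (1 : ℝ) ≤ X := by exact_mod_cast hX
      have hY : 1 ≤ c₁ * X := by nlinarith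
      calc |N' (c₁ * X) - κ * (c₁ * X) ^ (5 / 6 : ℝ)| ≤ C * (c₁ * X) ^ (3 / 4 + 1 / 24 : ℝ) :=
            hC _ hY
        _ ≤ |C| * (c₁ * X) ^ (3 / 4 + 1 / 24 : ℝ) :=
            mul_le_mul_of_nonneg_right (le_abs_self C) (by positivity)
        _ = |C| * c₁ ^ (3 / 4 + 1 / 24 : ℝ) * (X : ℝ) ^ (3 / 4 + 1 / 24 : ℝ) := by
            rw [Real.mul_rpow hc₁pos.le (by positivity)]; ring
    have hdiff' : Tendsto (fun X : ℕ ↦ (N' (c₁ * X) - κ * (c₁ * X) ^ (5 / 6 : ℝ)) /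
        (X : ℝ) ^ (5 / 6 : ℝ)) atTop (𝓝 0) := by
      rw [tendsto_zero_iff_abs_tendsto_zero]
      refine hdiff.congr fun X ↦ ?_
      simp only [Function.comp_apply]
      rw [abs_div, abs_of_nonneg (by positivity : (0 : ℝ) ≤ (X : ℝ) ^ (5 / 6 : ℝ))]
    have hk : Tendsto (fun X : ℕ ↦ κ * (c₁ * X) ^ (5 / 6 : ℝ) / (X : ℝ) ^ (5 / 6 : ℝ)) atTop
        (𝓝 (κ * c₁ ^ (5 / 6 : ℝ))) := by
      refine tendsto_const_nhds.congr' ?_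
      filter_upwards [eventually_ge_atTop 1] with X hX
      have hX0 : (0 : ℝ) < X := by exact_mod_cast hX
      rw [Real.mul_rpow hc₁pos.le hX0.le]
      field_simp
    have := hdiff'.add hk
    rw [zero_add] at this
    refine this.congr' ?_
    filter_upwards [eventually_ge_atTop 1] with X hX
    have hX0 : (0 : ℝ) < (X : ℝ) ^ (5 / 6 : ℝ) := Real.rpow_pos_of_pos (by exact_mod_cast hX) _
    field_simp
    ring
  -- (2) hence eventually `N'(c₁X)·P ≤ (2c_F + ε/2)·X^{5/6}`
  have hmain : ∀ᶠ X : ℕ in atTop, N' (c₁ * X) * P ≤ (2 * heightFamilyConstant + ε / 2) *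
      (X : ℝ) ^ (5 / 6 : ℝ) := by
    have hlim : Tendsto (fun X : ℕ ↦ N' (c₁ * X) * P / (X : ℝ) ^ (5 / 6 : ℝ)) atTop
        (𝓝 (2 * heightFamilyConstant)) := by
      rw [← hconst]
      refine (hN'lim.mul_const P).congr fun X ↦ ?_
      ring
    filter_upwards [hlim.eventually_lt_const (lt_add_of_pos_right _ (half_pos hε)),
      eventually_gt_atTop 0] with X hX hX0
    have hXpow : 0 < (X : ℝ) ^ (5 / 6 : ℝ) := Real.rpow_pos_of_pos (by exact_mod_cast hX0) _
    exact ((div_lt_iff₀ hXpow).mp hX).le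
  -- (3) the upper sieve step along `X' = (27/4)·X` (`2¹² X' = c₁ X`), with `ε' (27/4)^{5/6} = ε/2`
  have hu : Tendsto (fun X : ℕ ↦ (27 / 4 : ℝ) * X) atTop atTop :=
    Tendsto.const_mul_atTop (by norm_num) tendsto_natCast_atTop_atTop
  have h274 : (0 : ℝ) < (27 / 4 : ℝ) ^ (5 / 6 : ℝ) := Real.rpow_pos_of_pos (by norm_num) _
  have hsieve : ∀ᶠ X : ℕ in atTop, L (c₁ * X) ≤ N' (c₁ * X) * P + ε / 2 * (X : ℝ) ^ (5 / 6 : ℝ) := by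
    have h := hu.eventually (hU (ε / 2 / (27 / 4 : ℝ) ^ (5 / 6 : ℝ)) (by positivity))
    filter_upwards [h, eventually_gt_atTop 0] with X hX hX0
    have hXr : (0 : ℝ) < X := by exact_mod_cast hX0
    have e1 : (2 : ℝ) ^ 12 * (27 / 4 * (X : ℝ)) = c₁ * X := by rw [hc₁]; ring
    have e2 : ε / 2 / (27 / 4 : ℝ) ^ (5 / 6 : ℝ) * (27 / 4 * (X : ℝ)) ^ (5 / 6 : ℝ) =
        ε / 2 * (X : ℝ) ^ (5 / 6 : ℝ) := by
      rw [Real.mul_rpow (by norm_num) hXr.le]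
      field_simp
    simpa only [hL, hN', hP, e1, e2] using hX
  -- (4) assemble
  filter_upwards [hmain, hsieve] with X hX₁ hX₂
  rw [← Nat.cast_sum, sum_pgl2QClassCount_eq_locSolIrredClassCount h16 X]
  have e3 : (2 : ℝ) ^ 10 * 27 * (X : ℝ) = c₁ * X := by rw [hc₁]
  rw [e3]
  calc (locSolIrredClassCount (c₁ * X) : ℝ) = L (c₁ * X) := rfl
    _ ≤ N' (c₁ * X) * P + ε / 2 * (X : ℝ) ^ (5 / 6 : ℝ) := hX₂
    _ ≤ (2 * heightFamilyConstant + ε / 2) * (X : ℝ) ^ (5 / 6 : ℝ) + ε / 2 * (X : ℝ) ^ (5 / 6 : ℝ) := by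
        gcongr
    _ = (2 * heightFamilyConstant + ε) * (X : ℝ) ^ (5 / 6 : ℝ) := by ring


/-! ## §3. (U31) ⇒ Theorem 1.1 in `limsup` form ⇒ Cor. 1.2 -/

/-- **The upper half of eq. (31) suffices for Theorem 1.1 in `limsup` form**
(`heightAverageLE_card_selmerTwo`: the average of `#S₂(E)` over the curves of height `< X` is
eventually `≤ 3 + ε`). As in §5.4 of the source: by Thm 5.6 and the identity class,
`Σ #S₂(E) = [Σ #irr − Σ_{2-torsion} #irr] + [N_X − N_T] + Σ_{2-torsion} #S₂ ≤ Σ #irr + N_X +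
Σ_{2-torsion} #S₂` (`sum_card_selmerTwo_eq`), where `Σ_{2-torsion} #S₂ = O(X^{3/4+1/24})`
(Prop. 5.8, `bhargavaShankar_sum_card_selmerTwo_twoTorsion_le_holds`) and `N_X ~ c_F X^{5/6}`
(Lemma 5.15, `card_heightFamilyBelow_asymptotic_holds`); so `Avg #S₂ ≤ 1 + [(2c_F + ε₁)X^{5/6} +
O(X^{19/24})]/N_X → 3 + ε₁/c_F`. [cite: BhargavaShankarAnnals2015, Thm 1.1 and §5.4 (arXiv:1006.1002v2 numbering)] -/
theorem heightAverageLE_card_selmerTwo_of_sum_irredClassCount_le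
    (hS : ∀ ε : ℝ, 0 < ε → ∀ᶠ X : ℕ in atTop,
      (∑ AB ∈ heightFamilyBelow X,
          (pgl2QClassCount {f : BinaryQuartic ℤ | f.IsLocallySoluble ∧ f.IsIrreducible ∧
              f.I = 2 ^ 4 * (-3 * AB.1) ∧ f.J = 2 ^ 6 * (-27 * AB.2)} : ℝ)) ≤
        (2 * heightFamilyConstant + ε) * (X : ℝ) ^ (5 / 6 : ℝ)) :
    heightAverageLE_card_selmerTwo := by
  intro ε hε
  have hc := heightFamilyConstant_pos
  have h56 := bhargavaShankar_card_selmerTwo_eq_holds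
  set ε₁ : ℝ := ε * heightFamilyConstant / 2 with hε₁
  have hε₁pos : 0 < ε₁ := by positivity
  -- the pieces, divided by `X^{5/6}`
  have limN : Tendsto (fun X : ℕ ↦ ((heightFamilyBelow X).card : ℝ) / (X : ℝ) ^ (5 / 6 : ℝ))
      atTop (𝓝 heightFamilyConstant) := card_heightFamilyBelow_asymptotic_holds
  obtain ⟨C, hC⟩ := bhargavaShankar_sum_card_selmerTwo_twoTorsion_le_holds (1 / 24) (by norm_num)
  have limST : Tendsto (fun X : ℕ ↦ (∑ AB ∈ ((heightFamilyBelow X).filter HasRationalTwoTorsion),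
      (Nat.card ((shortWeierstrass AB).selmerGroup 2) : ℝ)) / (X : ℝ) ^ (5 / 6 : ℝ)) atTop (𝓝 0) :=
    tendsto_div_rpow_fiveSixths_of_le (C := C) (a := 3 / 4 + 1 / 24) (by norm_num)
      (fun X ↦ Finset.sum_nonneg fun _ _ ↦ by positivity) (fun X _ ↦ hC X)
  -- `g(X) = [(2c_F + ε₁) + Σ_T #S₂/X^{5/6}] / [N_X/X^{5/6}] → (2c_F + ε₁)/c_F = 2 + ε/2`
  have limg : Tendsto (fun X : ℕ ↦ ((2 * heightFamilyConstant + ε₁) +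
      (∑ AB ∈ ((heightFamilyBelow X).filter HasRationalTwoTorsion),
        (Nat.card ((shortWeierstrass AB).selmerGroup 2) : ℝ)) / (X : ℝ) ^ (5 / 6 : ℝ)) /
      (((heightFamilyBelow X).card : ℝ) / (X : ℝ) ^ (5 / 6 : ℝ))) atTop (𝓝 (2 + ε / 2)) := by
    have e : (2 * heightFamilyConstant + ε₁) / heightFamilyConstant = 2 + ε / 2 := by
      rw [hε₁]; field_simp
    have h := ((tendsto_const_nhds (x := 2 * heightFamilyConstant + ε₁)).add limST).div limN hc.ne'
    rw [add_zero, e] at h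
    exact h
  have hg : ∀ᶠ X : ℕ in atTop, ((2 * heightFamilyConstant + ε₁) +
      (∑ AB ∈ ((heightFamilyBelow X).filter HasRationalTwoTorsion),
        (Nat.card ((shortWeierstrass AB).selmerGroup 2) : ℝ)) / (X : ℝ) ^ (5 / 6 : ℝ)) /
      (((heightFamilyBelow X).card : ℝ) / (X : ℝ) ^ (5 / 6 : ℝ)) < 2 + ε :=
    limg.eventually_lt_const (by linarith)
  have hNpos : ∀ᶠ X : ℕ in atTop, (0 : ℝ) < ((heightFamilyBelow X).card : ℝ) / (X : ℝ) ^ (5 / 6 : ℝ) :=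
    limN.eventually_const_lt hc
  filter_upwards [hS ε₁ hε₁pos, hg, hNpos, eventually_gt_atTop 0] with X hI hgX hNX hX0
  have hXpow : 0 < (X : ℝ) ^ (5 / 6 : ℝ) := Real.rpow_pos_of_pos (by exact_mod_cast hX0) _
  have hN : (0 : ℝ) < ((heightFamilyBelow X).card : ℝ) := by
    have := mul_pos hNX hXpow
    rwa [div_mul_cancel₀ _ hXpow.ne'] at this
  -- abbreviations for the pieces at this `X`
  set I : ℝ := ∑ AB ∈ heightFamilyBelow X,
      (pgl2QClassCount {f : BinaryQuartic ℤ | f.IsLocallySoluble ∧ f.IsIrreducible ∧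
        f.I = 2 ^ 4 * (-3 * AB.1) ∧ f.J = 2 ^ 6 * (-27 * AB.2)} : ℝ) with hIdef
  set IT : ℝ := ∑ AB ∈ (heightFamilyBelow X).filter HasRationalTwoTorsion,
      (pgl2QClassCount {f : BinaryQuartic ℤ | f.IsLocallySoluble ∧ f.IsIrreducible ∧
        f.I = 2 ^ 4 * (-3 * AB.1) ∧ f.J = 2 ^ 6 * (-27 * AB.2)} : ℝ) with hITdef
  set N : ℝ := ((heightFamilyBelow X).card : ℝ) with hNdef
  set NT : ℝ := (((heightFamilyBelow X).filter HasRationalTwoTorsion).card : ℝ) with hNTdef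
  set ST : ℝ := ∑ AB ∈ (heightFamilyBelow X).filter HasRationalTwoTorsion,
      (Nat.card ((shortWeierstrass AB).selmerGroup 2) : ℝ) with hSTdef
  set P : ℝ := (X : ℝ) ^ (5 / 6 : ℝ) with hPdef
  have hIT : 0 ≤ IT := Finset.sum_nonneg fun _ _ ↦ Nat.cast_nonneg _
  have hNT : 0 ≤ NT := Nat.cast_nonneg _
  have hSel : (∑ AB ∈ heightFamilyBelow X, (Nat.card ((shortWeierstrass AB).selmerGroup 2) : ℝ)) ≤
      I + N + ST := by
    rw [sum_card_selmerTwo_eq h56 X]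
    change I - IT + (N - NT) + ST ≤ I + N + ST
    linarith
  -- the bound on the average
  unfold heightAverage
  have hgX' : ((2 * heightFamilyConstant + ε₁) * P + ST) / N < 2 + ε := by
    have e : ((2 * heightFamilyConstant + ε₁) + ST / P) / (N / P) =
        ((2 * heightFamilyConstant + ε₁) * P + ST) / N := by
      field_simp
    rw [← e]; exact hgX
  calc (∑ AB ∈ heightFamilyBelow X, (Nat.card ((shortWeierstrass AB).selmerGroup 2) : ℝ)) / N
      ≤ (I + N + ST) / N := div_le_div_of_nonneg_right hSel hN.le
    _ = 1 + (I + ST) / N := by field_simp; ring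
    _ ≤ 1 + ((2 * heightFamilyConstant + ε₁) * P + ST) / N := by
        gcongr
    _ ≤ 3 + ε := by linarith

/-- **Cor. 1.2 (`averageRankLE_three_halves`) from the upper half of eq. (31) alone.**
[cite: BhargavaShankarAnnals2015, Cor. 1.2] -/
theorem averageRankLE_three_halves_of_sum_irredClassCount_le
    (hS : ∀ ε : ℝ, 0 < ε → ∀ᶠ X : ℕ in atTop,
      (∑ AB ∈ heightFamilyBelow X,
          (pgl2QClassCount {f : BinaryQuartic ℤ | f.IsLocallySoluble ∧ f.IsIrreducible ∧
              f.I = 2 ^ 4 * (-3 * AB.1) ∧ f.J = 2 ^ 6 * (-27 * AB.2)} : ℝ)) ≤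
        (2 * heightFamilyConstant + ε) * (X : ℝ) ^ (5 / 6 : ℝ)) :
    averageRankLE_three_halves :=
  averageRankLE_three_halves_of_heightAverageLE_card_selmerTwo
    (heightAverageLE_card_selmerTwo_of_sum_irredClassCount_le hS)

/-- **Theorem 1.1 in `limsup` form from the upper sieve step (U†) and Thm 2.1.**
[cite: BhargavaShankarAnnals2015, Thm 1.1 (arXiv:1006.1002v2 numbering)] -/
theorem heightAverageLE_card_selmerTwo_of_upperSieve
    (hU : ∀ ε : ℝ, 0 < ε → ∀ᶠ X : ℝ in atTop,
      (locSolIrredClassCount (2 ^ 12 * X) : ℝ) ≤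
        (gl2zClassCount (fourRealRoots ∪ posDefinite ∪ twoRealRoots) (2 ^ 12 * X) : ℝ) *
            (∏' p : Nat.Primes, ((padicNorm p (2 ^ 10 / 3 ^ 3) : ℚ) : ℝ) *
              @localMassV p ⟨p.2⟩) +
          ε * X ^ (5 / 6 : ℝ))
    (h16 : bhargavaShankar_classCount) : heightAverageLE_card_selmerTwo :=
  heightAverageLE_card_selmerTwo_of_sum_irredClassCount_le (sum_irredClassCount_le_of_upperSieve hU h16)

/-- **Bhargava–Shankar, Cor. 1.2 (average rank `≤ 3/2`, `averageRankLE_three_halves`) from the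
UPPER sieve step (U†) and Thm 2.1** — the new frontier of the named fact: no uniformity estimate
(Prop. 5.13 / Thm 2.13), no [dodqf], no Delone–Evertse; every other printed step is a theorem of
the tree. [cite: BhargavaShankarAnnals2015, Cor. 1.2] -/
theorem averageRankLE_three_halves_of_upperSieve
    (hU : ∀ ε : ℝ, 0 < ε → ∀ᶠ X : ℝ in atTop,
      (locSolIrredClassCount (2 ^ 12 * X) : ℝ) ≤
        (gl2zClassCount (fourRealRoots ∪ posDefinite ∪ twoRealRoots) (2 ^ 12 * X) : ℝ) *
            (∏' p : Nat.Primes, ((padicNorm p (2 ^ 10 / 3 ^ 3) : ℚ) : ℝ) *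
              @localMassV p ⟨p.2⟩) +
          ε * X ^ (5 / 6 : ℝ))
    (h16 : bhargavaShankar_classCount) : averageRankLE_three_halves :=
  averageRankLE_three_halves_of_sum_irredClassCount_le (sum_irredClassCount_le_of_upperSieve hU h16)

/-- Sanity check of the re-routing: the old two-fact frontier factors through the new one
((†) ⇒ (U†)). [cite: BhargavaShankarAnnals2015, Cor. 1.2] -/
theorem averageRankLE_three_halves_of_two_facts'
    (hG : bhargavaShankar_locSolIrredClassCount_asymptotic) (h16 : bhargavaShankar_classCount) :
    averageRankLE_three_halves :=
  averageRankLE_three_halves_of_upperSieve (upperSieveStep_of_sieveStep hG) h16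

end Literature.NumberTheory.EllipticCurves

end
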